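import Summits.CriticalPhenomena.PercolationContinuityZ3.Theorems.SahiMasterFamilyTopCoeff
import Literature.Probability.LatticeModels.KahnPositiveAssociation

/-!
# Minors of a triple of events and the reduction of (T) to its terminal class (Theorem R skeleton)

Companion of `SahiMasterFamilyHeredity.lean`, `SahiMasterFamilyCommonPivotal.lean`, `SahiMasterFamilyTopCoeff.lean`
(unit `prim-master-conj`; (T) = `SahiE3NonvanishingOfPairwiseDependent`, the identically-zero form of the `k = 3`
master equality conjecture).  The unit's paper proof of (T) (STRUCTURE-PROOF.md, verified VERIFICATION-gen3.md) is an
induction on the number of coordinates through MINORS (deletion / contraction of one coordinate); this file formalises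
the induction and isolates exactly what is left to the combinatorics of up-sets:

* `secAt e b A` — the `e`-section of the event `A` (`b = true`: contraction `{ω | ω ∪ {e} ∈ A}`; `b = false`: deletion
  `{ω | ω ∖ {e} ∈ A}`), an event on the SAME index type that ignores `e`, is increasing if `A` is, and is determined by
  `S ∖ {e}` if `A` is determined by `S`;
* **transfer** (`sahiE_three_sec_eq_zero_of_forall`): if `E_3(μ_p; 1_{U_0},1_{U_1},1_{U_2}) = 0` for every interior `p`,
  then the same holds for the triple of `e`-sections (either `b`).  Proof: the vanishing makes the polynomial
  `sahiE3Poly` zero (Nullstellensatz, `SahiMasterFamilyTopCoeff.lean`), hence `E_3` vanishes also at the boundary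
  parameter `p[e ↦ b]`, where it coincides with `E_3` of the sections, which does not depend on `p_e`;
* **Theorem R skeleton** (`sahiE3Nonvanishing_of_terminal`): (T) follows from its TERMINAL case — pairwise-dependent
  triples of increasing events with no common pivotal coordinate ALL of whose minors lie in the zero-flag class `Z_3` —
  by induction on the size of a determining set: a common pivotal coordinate is `sahiE3Nonvanishing_of_common_pivotal`
  ((T-a)); a minor outside `Z_3` is either pairwise dependent (induction) or has an independent pair
  (`sahiE_three_ind_eq_zero_iff_of_indepPair`), and transfer lifts its non-vanishing.
On paper the terminal class consists of the triangle and the "bowties" (STRUCTURE-PROOF.md §11–§13: Lemma P + SC-np),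
whose events `AND(P)·OR(Q)` have top Möbius coefficient `±1`, so `sahiE3Nonvanishing_of_mobCoeff` finishes; that
classification is the part of (T) not yet formalised.  Everything here is proved; axioms standard. [this work]
-/

noncomputable section

open scoped Classical

namespace Summit.CriticalPhenomena.PercolationContinuityZ3.Theorems

open Finset Function MvPolynomial
open Literature.Combinatorics.Sahi2008
open Literature.Probability.Percolation (DeterminedBy determinedBy_iff)
open Literature.Probability.Percolation.BHK2006 (weight ind_inter)
open Literature.Probability.Percolation.DecisionTree (ind ind_of_mem ind_of_not_mem ind_nonneg)

section Sections

variable {ι : Type*}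

/-- Forcing coordinate `e` to the value `b`: `ω ↦ ω ∪ {e}` (`b = true`) or `ω ↦ ω ∖ {e}` (`b = false`). [folklore] -/
def forceAt (e : ι) (b : Bool) (ω : Set ι) : Set ι := cond b (insert e ω) (ω \ {e})

/-- **The `e`-section of an event** (`b = true`: contraction `A^e = {ω | ω ∪ {e} ∈ A}` = Kahn's `secIn`;
`b = false`: deletion `A_e = {ω | ω ∖ {e} ∈ A}` = `secOut`), as an event on the same index type. [folklore] -/
def secAt (e : ι) (b : Bool) (A : Set (Set ι)) : Set (Set ι) :=
  cond b (Literature.Probability.LatticeModels.Kahn2022.secIn A e) (Literature.Probability.LatticeModels.Kahn2022.secOut A e)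

/-- Membership in a section: `ω ∈ A^{e←b} ↔ forceAt e b ω ∈ A`. [folklore] -/
theorem mem_secAt {e : ι} {b : Bool} {A : Set (Set ι)} {ω : Set ι} : ω ∈ secAt e b A ↔ forceAt e b ω ∈ A := by
  cases b <;> rfl

/-- Forcing is idempotent in the configuration's `e`-coordinate: it ignores whether `e ∈ ω`. [folklore] -/
theorem forceAt_insert (e : ι) (b : Bool) (ω : Set ι) : forceAt e b (insert e ω) = forceAt e b ω := by
  cases b <;> simp [forceAt]

/-- Forcing does nothing to a configuration already having the forced value. [folklore] -/
theorem forceAt_of_iff {e : ι} {b : Bool} {ω : Set ι} (h : e ∈ ω ↔ b = true) : forceAt e b ω = ω := by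
  cases b
  · simp only [forceAt, cond_false]
    exact Set.sdiff_singleton_eq_self fun he => by simpa using h.1 he
  · simp only [forceAt, cond_true]
    exact Set.insert_eq_of_mem (h.2 rfl)

/-- Off `e`, forcing does not change the configuration. [folklore] -/
theorem forceAt_inter_of_notMem {e : ι} (b : Bool) (ω : Set ι) {F : Set ι} (he : e ∉ F) :
    forceAt e b ω ∩ F = ω ∩ F := by
  cases b
  · ext i; simp only [forceAt, cond_false, Set.mem_inter_iff, Set.mem_sdiff, Set.mem_singleton_iff]
    constructor
    · rintro ⟨⟨hi, -⟩, hiF⟩; exact ⟨hi, hiF⟩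
    · rintro ⟨hi, hiF⟩; exact ⟨⟨hi, fun hie => he (hie ▸ hiF)⟩, hiF⟩
  · ext i; simp only [forceAt, cond_true, Set.mem_inter_iff, Set.mem_insert_iff]
    constructor
    · rintro ⟨hi | hi, hiF⟩
      · exact absurd hiF (hi ▸ he)
      · exact ⟨hi, hiF⟩
    · rintro ⟨hi, hiF⟩; exact ⟨Or.inr hi, hiF⟩

/-- Sections ignore `e`. [folklore] -/
theorem insert_mem_secAt_iff (e : ι) (b : Bool) (A : Set (Set ι)) (ω : Set ι) :
    insert e ω ∈ secAt e b A ↔ ω ∈ secAt e b A := by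
  rw [mem_secAt, mem_secAt, forceAt_insert]

/-- Sections of increasing events are increasing. [folklore] -/
theorem isUpperSet_secAt (e : ι) (b : Bool) {A : Set (Set ι)} (hA : IsUpperSet A) : IsUpperSet (secAt e b A) := by
  intro ω ω' hle hω
  rw [mem_secAt] at hω ⊢
  refine hA ?_ hω
  cases b
  · simp only [forceAt, cond_false]; exact Set.sdiff_subset_sdiff_left hle
  · simp only [forceAt, cond_true]; exact Set.insert_subset_insert hle

/-- A section of an event determined by `S` is determined by `S ∖ {e}`. [folklore] -/
theorem determinedBy_secAt (e : ι) (b : Bool) {A : Set (Set ι)} {S : Finset ι} (hA : DeterminedBy A (↑S : Set ι)) :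
    DeterminedBy (secAt e b A) (↑(S.erase e) : Set ι) := by
  rw [determinedBy_iff] at hA ⊢
  intro ω ω' h
  rw [mem_secAt, mem_secAt]
  refine hA _ _ ?_
  ext i
  by_cases hie : i = e
  · subst hie
    cases b <;> simp [forceAt]
  · have key : i ∈ ω ∩ ↑(S.erase e) ↔ i ∈ ω' ∩ ↑(S.erase e) := by rw [h]
    simp only [Set.mem_inter_iff, Finset.mem_coe, Finset.mem_erase, hie, ne_eq, not_false_eq_true, true_and] at key
    cases b
    · simp only [forceAt, cond_false, Set.mem_inter_iff, Set.mem_sdiff, Set.mem_singleton_iff, hie,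
        not_false_eq_true, and_true, Finset.mem_coe]
      exact key
    · simp only [forceAt, cond_true, Set.mem_inter_iff, Set.mem_insert_iff, hie, false_or, Finset.mem_coe]
      exact key

/-- Sections commute with intersections. [folklore] -/
theorem secAt_inter (e : ι) (b : Bool) (A B : Set (Set ι)) : secAt e b (A ∩ B) = secAt e b A ∩ secAt e b B := by
  cases b <;> rfl

end Sections

/-! ### Transfer: `E_3 ≡ 0` passes to the sections -/

section Transfer

variable {ι : Type*} [Fintype ι]

/-- The boundary parameter value `b ∈ {0, 1}` as a point of the unit interval. [folklore] -/
def boolParam (b : Bool) : unitInterval := if b then 1 else 0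

/-- At the boundary parameter `p_e = b`, the expectation of `1_A` is the section moment `X_b(1_A)`, which is the
expectation of the indicator of the `b`-section. [this work] -/
theorem ex_ind_update_boolParam (p : ι → unitInterval) (e : ι) (b : Bool) (A : Set (Set ι)) :
    ex (bernoulliWeight (update p e (boolParam b))) (ind A) =
      ex (bernoulliWeight (update p e (boolParam b))) (ind (secAt e b A)) := by
  rw [ex_update_eq, ex_update_eq]
  have hsec : ∀ b' : Bool, secEx p e (ind (secAt e b A)) b' = secEx p e (ind A) b := by
    intro b'
    simp only [secEx]
    refine sum_congr rfl fun ω hω => ?_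
    simp only [mem_filter, mem_univ, true_and] at hω
    congr 1
    have h1 : (if b' then insert e ω else ω) ∈ secAt e b A ↔ ω ∈ secAt e b A := by
      cases b'
      · simp
      · simp only [if_true]; exact insert_mem_secAt_iff e b A ω
    have h2 : ω ∈ secAt e b A ↔ (if b then insert e ω else ω) ∈ A := by
      rw [mem_secAt]
      cases b
      · simp only [forceAt, cond_false, Bool.false_eq_true, if_false]
        rw [Set.sdiff_singleton_eq_self hω]
      · simp [forceAt]
    by_cases hm : (if b then insert e ω else ω) ∈ A
    · rw [ind_of_mem hm, ind_of_mem (h1.2 (h2.2 hm))]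
    · rw [ind_of_not_mem hm, ind_of_not_mem fun h => hm (h2.1 (h1.1 h))]
  rw [hsec true, hsec false]
  cases b <;> simp [boolParam]

/-- The expectation of a function ignoring `e` does not depend on `p_e`. [folklore] -/
theorem ex_update_eq_of_ignores (p : ι → unitInterval) (e : ι) (s s' : unitInterval) {h : Set ι → ℝ}
    (hh : ∀ ω, h (insert e ω) = h ω) :
    ex (bernoulliWeight (update p e s)) h = ex (bernoulliWeight (update p e s')) h := by
  rw [ex_update_eq, ex_update_eq]
  have h10 : secEx p e h true = secEx p e h false := by
    simp only [secEx]
    refine sum_congr rfl fun ω _ => ?_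
    simp [hh ω]
  rw [h10]; ring

omit [Fintype ι] in
/-- Indicators of sections ignore `e`. [folklore] -/
theorem ind_secAt_insert (e : ι) (b : Bool) (A : Set (Set ι)) (ω : Set ι) :
    ind (secAt e b A) (insert e ω) = ind (secAt e b A) ω := by
  by_cases h : ω ∈ secAt e b A
  · rw [ind_of_mem h, ind_of_mem ((insert_mem_secAt_iff e b A ω).2 h)]
  · rw [ind_of_not_mem h, ind_of_not_mem fun h' => h ((insert_mem_secAt_iff e b A ω).1 h')]

/-- **`E_3` at the boundary parameter `p_e = b` is `E_3` of the `b`-sections.** [this work] -/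
theorem sahiE_three_update_boolParam (p : ι → unitInterval) (e : ι) (b : Bool) (U : Fin 3 → Set (Set ι)) :
    sahiE (bernoulliWeight (update p e (boolParam b))) 3 (fun j => ind (U j)) =
      sahiE (bernoulliWeight (update p e (boolParam b))) 3 (fun j => ind (secAt e b (U j))) := by
  -- `1_A · 1_B = 1_{A ∩ B}` (the tree's `ind_mul_ind_eq_inter`, restated locally to keep imports light)
  have ind_mul_ind_eq : ∀ A B : Set (Set ι), ind A * ind B = ind (A ∩ B) :=
    fun A B => funext fun ω => (ind_inter A B ω).symm
  rw [sahiE_three_apply, sahiE_three_apply]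
  simp only [ind_mul_ind_eq, ← secAt_inter]
  rw [← ex_ind_update_boolParam p e b (U 0 ∩ U 1 ∩ U 2), ← ex_ind_update_boolParam p e b (U 0),
    ← ex_ind_update_boolParam p e b (U 1), ← ex_ind_update_boolParam p e b (U 2),
    ← ex_ind_update_boolParam p e b (U 1 ∩ U 2), ← ex_ind_update_boolParam p e b (U 0 ∩ U 2),
    ← ex_ind_update_boolParam p e b (U 0 ∩ U 1)]

/-- **`E_3` of sections does not depend on `p_e`.** [this work] -/
theorem sahiE_three_secAt_update (p : ι → unitInterval) (e : ι) (b : Bool) (s s' : unitInterval)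
    (U : Fin 3 → Set (Set ι)) :
    sahiE (bernoulliWeight (update p e s)) 3 (fun j => ind (secAt e b (U j))) =
      sahiE (bernoulliWeight (update p e s')) 3 (fun j => ind (secAt e b (U j))) := by
  have ind_mul_ind_eq : ∀ A B : Set (Set ι), ind A * ind B = ind (A ∩ B) :=
    fun A B => funext fun ω => (ind_inter A B ω).symm
  rw [sahiE_three_apply, sahiE_three_apply]
  simp only [ind_mul_ind_eq, ← secAt_inter]
  have key : ∀ X : Set (Set ι), ex (bernoulliWeight (update p e s)) (ind (secAt e b X)) =
      ex (bernoulliWeight (update p e s')) (ind (secAt e b X)) :=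
    fun X => ex_update_eq_of_ignores p e s s' (ind_secAt_insert e b X)
  simp only [key]

/-- If `E_3(μ_p; 1_U) = 0` for every interior `p` then the polynomial `sahiE3Poly` vanishes. [this work] -/
theorem sahiE3Poly_eq_zero_of_forall (U : Fin 3 → Set (Set ι))
    (h : ∀ p : ι → unitInterval, (∀ e, (p e : ℝ) ∈ Set.Ioo (0 : ℝ) 1) →
      sahiE (bernoulliWeight p) 3 (fun j => ind (U j)) = 0) :
    sahiE3Poly (ind (U 0)) (ind (U 1)) (ind (U 2)) = 0 := by
  refine eq_zero_of_eval_zero_at_prod_finset _ (fun _ => gridFifths)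
    (fun e => (degreeOf_sahiE3Poly_le _ _ _ e).trans_lt (by rw [card_gridFifths]; norm_num)) ?_
  intro x hx
  have hx01 : ∀ e, x e ∈ Set.Ioo (0 : ℝ) 1 := fun e => mem_Ioo_of_mem_gridFifths (hx e)
  have hF : (fun j => ind (U j)) = ![ind (U 0), ind (U 1), ind (U 2)] := by
    funext j; fin_cases j <;> rfl
  have := h (fun e => ⟨x e, (hx01 e).1.le, (hx01 e).2.le⟩) hx01
  rw [hF] at this
  rw [eval_sahiE3Poly]
  exact this

/-- **Transfer.** If `E_3(μ_p; 1_{U_0},1_{U_1},1_{U_2}) = 0` for every interior `p`, then for every coordinate `e` and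
`b ∈ {0,1}` the triple of `e`-sections also has `E_3 = 0` at every interior `p` (indeed at every `p`). [this work] -/
theorem sahiE_three_sec_eq_zero_of_forall (U : Fin 3 → Set (Set ι))
    (h : ∀ p : ι → unitInterval, (∀ e, (p e : ℝ) ∈ Set.Ioo (0 : ℝ) 1) →
      sahiE (bernoulliWeight p) 3 (fun j => ind (U j)) = 0)
    (e : ι) (b : Bool) (p : ι → unitInterval) :
    sahiE (bernoulliWeight p) 3 (fun j => ind (secAt e b (U j))) = 0 := by
  have hpoly := sahiE3Poly_eq_zero_of_forall U h
  -- `E_3(U)` at the boundary parameter `p[e ↦ b]` is an evaluation of the zero polynomial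
  have hbd : sahiE (bernoulliWeight (update p e (boolParam b))) 3 (fun j => ind (U j)) = 0 := by
    have hF : (fun j => ind (U j)) = ![ind (U 0), ind (U 1), ind (U 2)] := by
      funext j; fin_cases j <;> rfl
    rw [hF, show bernoulliWeight (update p e (boolParam b)) =
      weight (fun i => ((update p e (boolParam b) i : unitInterval) : ℝ)) from rfl, ← eval_sahiE3Poly, hpoly, map_zero]
  rw [sahiE_three_update_boolParam] at hbd
  have hp : p = update p e (p e) := by rw [update_eq_self]
  rw [hp, sahiE_three_secAt_update p e b (p e) (boolParam b)]
  exact hbd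

/-- **Transfer, contrapositive**: non-vanishing of `E_3` for a triple of sections at some interior parameter lifts to
the original triple. [this work] -/
theorem exists_sahiE_three_ne_zero_of_sec (U : Fin 3 → Set (Set ι)) (e : ι) (b : Bool)
    (h : ∃ p : ι → unitInterval, (∀ i, (p i : ℝ) ∈ Set.Ioo (0 : ℝ) 1) ∧
      sahiE (bernoulliWeight p) 3 (fun j => ind (secAt e b (U j))) ≠ 0) :
    ∃ p : ι → unitInterval, (∀ i, (p i : ℝ) ∈ Set.Ioo (0 : ℝ) 1) ∧
      sahiE (bernoulliWeight p) 3 (fun j => ind (U j)) ≠ 0 := by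
  by_contra hall
  push Not at hall
  obtain ⟨p, _, hne⟩ := h
  exact hne (sahiE_three_sec_eq_zero_of_forall U hall e b p)

end Transfer

/-! ### Theorem R: reduction of (T) to the terminal class -/

/-- **The terminal class of (T)** (the paper's `S(n)`): a triple of events, with a determining set `S`, that is pairwise
dependent, has NO coordinate pivotal for all three events, and ALL of whose minors (both `e`-sections, every `e ∈ S`)
lie in the zero-flag class `Z_3`.  (If `S` contains a coordinate on which no `U_j` depends, the last condition forces
`U ∈ Z_3`, contradicting pairwise dependence; so only essential coordinates matter.) [this work] -/
def TerminalTriple {ι : Type*} (U : Fin 3 → Set (Set ι)) (S : Finset ι) : Prop :=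
  PairwiseDependent U ∧
    (¬ ∃ e : ι, ∀ j, ∃ ω, e ∉ ω ∧ ω ∉ U j ∧ insert e ω ∈ U j) ∧
      ∀ e ∈ S, ∀ b : Bool, SuppZeroFlag 3 (fun j => secAt e b (U j))

/-- **(T) on the terminal class** (a statement; PROVED ON PAPER — STRUCTURE-PROOF.md §11–§13 with VERIFICATION-gen3.md:
the terminal triples are exactly the triangle and the bowties, for which `E_3 = ∏_e p_e(1−p_e)` — but not yet
formalised; never a fact): every terminal triple of increasing events on a finite `ι` has `E_3(μ_p) ≠ 0` for some
interior `p`.  Equivalent to (T) (`sahiE3Nonvanishing_iff_terminal`). [this work] [status: proved on paper, Lean open] -/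
@[conjecture] def SahiE3NonvanishingOfTerminal : Prop :=
  ∀ (ι : Type) [Fintype ι] (U : Fin 3 → Set (Set ι)) (S : Finset ι),
    (∀ j, IsUpperSet (U j)) → (∀ j, DeterminedBy (U j) (↑S : Set ι)) → TerminalTriple U S →
      ∃ p : ι → unitInterval, (∀ e, (p e : ℝ) ∈ Set.Ioo (0 : ℝ) 1) ∧
        sahiE (bernoulliWeight p) 3 (fun j => ind (U j)) ≠ 0

/-- **Theorem R (skeleton).**  If every terminal triple of increasing events has `E_3(μ_p) ≠ 0` for some interior `p`,
then (T) `SahiE3NonvanishingOfPairwiseDependent` holds.  Induction on the size of a determining set: a common pivotal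
coordinate is settled by (T-a); a minor outside `Z_3` is pairwise dependent (induction hypothesis) or has an independent
pair (`sahiE_three_ind_eq_zero_iff_of_indepPair` at the centre of the cube), and its non-vanishing transfers. [this work] -/
theorem sahiE3Nonvanishing_of_terminal (hterm : SahiE3NonvanishingOfTerminal) :
    SahiE3NonvanishingOfPairwiseDependent := by
  -- induction on the size of a determining set
  have main : ∀ (n : ℕ) (ι : Type) [Fintype ι] (U : Fin 3 → Set (Set ι)) (S : Finset ι), S.card = n →
      (∀ j, IsUpperSet (U j)) → (∀ j, DeterminedBy (U j) (↑S : Set ι)) → PairwiseDependent U →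
        ∃ p : ι → unitInterval, (∀ e, (p e : ℝ) ∈ Set.Ioo (0 : ℝ) 1) ∧
          sahiE (bernoulliWeight p) 3 (fun j => ind (U j)) ≠ 0 := by
    intro n
    induction n with
    | zero =>
      intro ι _ U S hS hU hUS hPD
      by_cases hc : ∃ e : ι, ∀ j, ∃ ω, e ∉ ω ∧ ω ∉ U j ∧ insert e ω ∈ U j
      · obtain ⟨e, he⟩ := hc
        exact sahiE3Nonvanishing_of_common_pivotal U hU e he
      · -- with `S = ∅` the minor condition is vacuous: the triple is terminal
        refine hterm ι U S hU hUS ⟨hPD, hc, fun e he => ?_⟩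
        rw [Finset.card_eq_zero.1 hS] at he
        exact absurd he (Finset.notMem_empty e)
    | succ n ih =>
      intro ι _ U S hS hU hUS hPD
      by_cases hT : TerminalTriple U S
      · exact hterm ι U S hU hUS hT
      · by_cases hc : ∃ e : ι, ∀ j, ∃ ω, e ∉ ω ∧ ω ∉ U j ∧ insert e ω ∈ U j
        · obtain ⟨e, he⟩ := hc
          exact sahiE3Nonvanishing_of_common_pivotal U hU e he
        · have hmin : ∃ e ∈ S, ∃ b : Bool, ¬ SuppZeroFlag 3 (fun j => secAt e b (U j)) := by
            by_contra hno
            push Not at hno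
            exact hT ⟨hPD, hc, hno⟩
          obtain ⟨e, heS, b, hZ⟩ := hmin
          set V : Fin 3 → Set (Set ι) := fun j => secAt e b (U j) with hV
          have hVup : ∀ j, IsUpperSet (V j) := fun j => isUpperSet_secAt e b (hU j)
          have hVdet : ∀ j, DeterminedBy (V j) (↑(S.erase e) : Set ι) := fun j => determinedBy_secAt e b (hUS j)
          have hcard : (S.erase e).card = n := by rw [Finset.card_erase_of_mem heS, hS]; rfl
          refine exists_sahiE_three_ne_zero_of_sec U e b ?_
          by_cases hVPD : PairwiseDependent V
          · exact ih ι V (S.erase e) hcard hVup hVdet hVPD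
          · simp only [PairwiseDependent, not_forall, not_not] at hVPD
            obtain ⟨m, hm⟩ := hVPD
            refine ⟨halfParams ι, halfParams_mem_Ioo ι, fun h0 => hZ ?_⟩
            exact (sahiE_three_ind_eq_zero_iff_of_indepPair (halfParams ι) (halfParams_mem_Ioo ι) V hVup m hm).1 h0
  intro ι _ U hU hPD
  -- every event on a finite type is determined by `univ`
  have hdet : ∀ j, DeterminedBy (U j) (↑(Finset.univ : Finset ι) : Set ι) := by
    intro j
    rw [determinedBy_iff]
    intro ω ω' h
    simp only [Finset.coe_univ, Set.inter_univ] at h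
    rw [h]
  exact main _ ι U Finset.univ rfl hU hdet hPD

/-- **(T) ⟺ (T) on the terminal class**: the converse is immediate since terminal triples are pairwise dependent.
So the analytic content of the `k = 3` master equality conjecture (`MasterFamilyIdentEqIff 3 ↔ (T)`,
`masterFamilyIdentEqIff_three_iff`) is reduced to the finite combinatorics of terminal triples of up-sets. [this work] -/
theorem sahiE3Nonvanishing_iff_terminal : SahiE3NonvanishingOfPairwiseDependent ↔ SahiE3NonvanishingOfTerminal :=
  ⟨fun hT ι _ U _ hU _ hterm => hT ι U hU hterm.1, sahiE3Nonvanishing_of_terminal⟩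

end Summit.CriticalPhenomena.PercolationContinuityZ3.Theorems
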